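import Summits.QuantumFields.BalabanUV.Beta.FP.PolarizationGerm
import Summits.QuantumFields.BalabanUV.Beta.FP.ExpLocalisedBubblePker

/-!
# `BalabanUV.Beta.FP.PolarizationGermPker` — road «FP» for binder row D1, leaf (H2), row **H2-ASM-5** (owner END), module A:
# THE GLUON-SECTOR END OF H2-ASM-3 AT THE PERFECT GLUON LEG `Pker` — H2-ASM-2's leg letters (L0)–(L3) and dictionary letters (D0)–(D2) of
# `legP = Re PinfKer` DISCHARGE every leg hypothesis of `PolarizationGerm.abs_bubble_sub_leadGerm_le`, so that for EVERY admissible cubic family `V`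
# (letters (a1) localisation, (a2) translation covariance, (a3) total zero mass on the field block) and every `z` with `4 ≤ ‖z‖∞`:
# `|bubble Pker (V μ 0) (V ν z) − leadGerm c₄ (cubicGermOf V) μ ν (toReal z)| ≤ Cbub 4 Cs δ A0P A1P A2P A3P D0P D1P D2P ∕ ‖z‖∞⁷`

HONEST DEPENDENCY (page 1, mandatory): continuum YM on T⁴ ⇐ BetaPertH ∧ nine spine estimates (0/9 proved); BetaPertH ⇐ (D1) ∧ (D4) ∧
CAP+tail; G-an2-4 gates asym, D1 and NE2/3/4.  HONEST FRAMING (cell contract, verbatim): «discharging `BetaPertH` makes Bałaban's UV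
stability UNCONDITIONAL — a real constructive-QFT result; it is NOT the continuum limit and NOT the Clay problem.»  THIS MODULE is wiring BY NAME of tree
theorems: gan24-formalise-leaf-02-g39's END `FP/PolarizationGerm.abs_bubble_sub_leadGerm_le` (H2-ASM-3b module 2), beta-d1-formalise-leaf-01's H2-ASM-2 letters
`FP/PerfectPropagatorLegData.{abs_legP_sub_invSq_le, abs_legP_diff_sub_d1_le, abs_legP_diff2_sub_hess_le}` ((D0)–(D2)) and beta-d1-formalise-leaf-02's junction
`FP/ExpLocalisedBubblePker.{letters_Pker_fwd, letters_Pker_bwd, abs_Pker_le, Pker_zero_inl_inl, Pker_zero_neg_inl_inl}` ((L0)–(L3), both orientations), and the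
H2V-0 object `FP/PerfectPolarization.Pker` (`Pker_translate`, `Pker_inl_inr`∕`_inr_inl`∕`_inr_inr`).  The only remaining hypotheses are the VERTEX letters
(a1)(a2)(a3) of the admissible family — the perfect action's own jets are row H2V-4, NOT constructed here.  No `def`, no `def … : Prop`, nothing cited, 0 sorry.
WHAT IT IS: a statement about an EXPLICIT object (the perfect propagator `Pker` on `ℤ⁴`) and an abstract admissible vertex family: the one-loop gluon bubble's
`‖z‖⁻⁶` germ IS `leadGerm c₄ (cubicGermOf V)` with an `O(‖z‖∞⁻⁷)` remainder and an explicit constant.  WHAT IT IS NOT: not the ghost sector (module B), not the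
tadpole (module B), not the colour∕normalisation step (H2-ASM-4 ✓ `PolarizationColour`) nor `hgerm` (module C); 0∕4 row-D1 binders; NOT hgerm, NOT D1, NOT BetaPertH,
NOT continuum, NOT Clay.

ABSOLUTE RULE (cell charter, verbatim): «No internally-minted statement may enter as a cited fact. Every hypothesis is either kernel-proved in this
package or a verbatim quotation of a PUBLISHED theorem with page reference. The manuscript(s) under audit are NOT citable for their own disputed
steps — they are the thing under adjudication; programme-internal (2001/route/tribunal) claims are never citable.»

CONTENT.
* §1 [folklore] the two spellings of the Kronecker dictionary (`MarginalUniqueness.δ α β * (c * X) = if β = α then c * X else 0` and the `α = β` twin), and the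
  `fwdDiff` unfoldings of the two orientations of `Pker`'s field block as `legP` (`Pker 0 t (inl α)(inl β) = legP α β t`, `Pker 0 (−t) (inl α)(inl β) = legP β α t`).
* §2 [our object] `dictF_Pker` ∕ `dictG_Pker` — the dictionary letters (D0)(D1)(D2) in EXACTLY the shapes `hDF` ∕ `hDG` of `abs_bubble_sub_leadGerm_le` at `R₀ = 4`, `cL = c₄`,
  `(D₀, D₁, D₂) = (D0P, D1P, D2P)`; `gradedF_Pker` ∕ `gradedG_Pker` — (L0)–(L3) in the shapes `hF` ∕ `hG` with `(A₀, A₁, A₂, A₃) = (A0P, A1P, A2P, A3P)`.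
* §3 [our object] **`abs_bubble_Pker_sub_leadGerm_le`** — THE GLUON-SECTOR END AT `Pker`.
Provenance: road FP OWNER b2b-balaban-beta-d1-p3 gen 8 (prover-b2b-balaban-beta-d1-p3-g8-0), 2026-08-21, row H2-ASM-5 module A; «not in print; our bookkeeping».
-/

noncomputable section

namespace Summit.QuantumFields.BalabanUV.Beta.FP.PolarizationGermPker

open Finset fwdDiff
open scoped BigOperators
open Literature.MathematicalPhysics.QuantumFieldTheory.Balaban1983to89
open Literature.MathematicalPhysics.QuantumFieldTheory.Balaban1983to89.Beta
open Literature.MathematicalPhysics.QuantumFieldTheory.Balaban1983to89.Beta.TransverseStructure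
open Literature.MathematicalPhysics.QuantumFieldTheory.Balaban1983to89.Beta.BubbleTransfer
open ExpKernelCalculus (Site MKer BiLoc bubble shiftK)
open OneStepResolventKernel (Fib LocStencil)
open DyadicShell (Pt supNorm toReal supNorm_pos supNorm_eq_zero_iff)
open Summit.QuantumFields.BalabanUV.Beta.FP.MarginalUniqueness (Idx CubicGerm)
open Summit.QuantumFields.BalabanUV.Beta.FP.WilsonCubicGerm (cubicGermOf)
open Summit.QuantumFields.BalabanUV.Beta.FP.PolarizationGermBubble (leadGerm)
open Summit.QuantumFields.BalabanUV.Beta.FP.PolarizationGermLegs (Cbub)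
open Summit.QuantumFields.BalabanUV.Beta.FP.PolarizationGerm (abs_bubble_sub_leadGerm_le)
open Summit.QuantumFields.BalabanUV.Beta.FP.PerfectPolarization (Pker Pker_inl_inr Pker_inr_inl Pker_inr_inr Pker_translate)
open Summit.QuantumFields.BalabanUV.Beta.FP.PerfectPropagatorLegData (legP A0P A1P A2P A3P D0P D1P D2P abs_legP_sub_invSq_le abs_legP_diff_sub_d1_le
  abs_legP_diff2_sub_hess_le)
open Summit.QuantumFields.BalabanUV.Beta.FP.ExpLocalisedBubblePker (letters_Pker_fwd letters_Pker_bwd abs_Pker_le Pker_zero_inl_inl Pker_zero_neg_inl_inl)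

/-! ## §1 Kronecker and orientation bookkeeping -/

/-- [folklore] the two spellings of the Kronecker dictionary term, reflected indices. -/
theorem delta_mul_eq_ite' (α β : Fin 4) (c X : ℝ) :
    MarginalUniqueness.δ α β * (c * X) = (if β = α then c * X else 0) := by
  unfold MarginalUniqueness.δ
  by_cases h : α = β
  · subst h; simp
  · rw [if_neg h, if_neg (fun h' => h h'.symm)]; ring

/-- [folklore] the two spellings of the Kronecker dictionary term. -/
theorem delta_mul_eq_ite (α β : Fin 4) (c X : ℝ) :
    MarginalUniqueness.δ α β * (c * X) = (if α = β then c * X else 0) := by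
  unfold MarginalUniqueness.δ
  by_cases h : α = β
  · subst h; simp
  · rw [if_neg h, if_neg h]; ring

/-- [our object] the forward orientation of `Pker`'s field block as a function: `v ↦ Pker 0 v (inl α)(inl β)` IS `legP α β`. -/
theorem Pker_fwd_eq_legP (α β : Fin 4) : (fun v : Pt => Pker 0 v (Sum.inl α) (Sum.inl β)) = legP α β :=
  funext fun v => Pker_zero_inl_inl v α β

/-- [our object] the reflected orientation of `Pker`'s field block as a function: `v ↦ Pker 0 (−v) (inl α)(inl β)` IS the transposed leg `legP β α`. -/
theorem Pker_bwd_eq_legP (α β : Fin 4) : (fun v : Pt => Pker 0 (-v) (Sum.inl α) (Sum.inl β)) = legP β α :=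
  funext fun v => Pker_zero_neg_inl_inl v α β

/-- [folklore] the first forward difference, unfolded. -/
theorem fwdDiff_apply' (f : Pt → ℝ) (h t : Pt) : Δ_[h] f t = f (t + h) - f t := rfl

/-- [folklore] the second forward difference, unfolded to the four-point combination of (D2). -/
theorem fwdDiff₂_apply' (f : Pt → ℝ) (h k t : Pt) :
    Δ_[h] (Δ_[k] f) t = f (t + h + k) - f (t + h) - f (t + k) + f t := by
  simp only [fwdDiff]
  ring

/-! ## §2 The leg letters of `Pker` in the END's shapes -/

/-- [our object] **(D0)–(D2) FOR THE REFLECTED ORIENTATION** in the shape `hDF` of `PolarizationGerm.abs_bubble_sub_leadGerm_le` (`R₀ = 4`, `cL = c₄`). -/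
theorem dictF_Pker (α β : Fin 4) (t : Pt) (ht : 4 ≤ supNorm t) :
    |Pker 0 (-t) (Sum.inl α) (Sum.inl β) - MarginalUniqueness.δ α β * (c4 * invSq (toReal t))| ≤ D0P / (supNorm t : ℝ) ^ 3
      ∧ (∀ i, |Δ_[(Pi.single i 1 : Pt)] (fun v => Pker 0 (-v) (Sum.inl α) (Sum.inl β)) t
          - MarginalUniqueness.δ α β * (c4 * d1InvSq i (toReal t))| ≤ D1P / (supNorm t : ℝ) ^ 4)
      ∧ (∀ i j, |Δ_[(Pi.single i 1 : Pt)] (Δ_[(Pi.single j 1 : Pt)] (fun v => Pker 0 (-v) (Sum.inl α) (Sum.inl β))) t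
          - MarginalUniqueness.δ α β * (c4 * hessInvSq i j (toReal t))| ≤ D2P / (supNorm t : ℝ) ^ 5) := by
  have ht0 : t ≠ 0 := by
    intro h; rw [h] at ht; rw [supNorm_eq_zero_iff.mpr rfl] at ht; omega
  have ht2 : 2 ≤ supNorm t := le_trans (by norm_num) ht
  refine ⟨?_, fun i => ?_, fun i j => ?_⟩
  · rw [Pker_zero_neg_inl_inl, delta_mul_eq_ite']
    exact abs_legP_sub_invSq_le β α ht0
  · rw [Pker_bwd_eq_legP, fwdDiff_apply', delta_mul_eq_ite']
    exact abs_legP_diff_sub_d1_le β α i ht2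
  · rw [Pker_bwd_eq_legP, fwdDiff₂_apply', delta_mul_eq_ite']
    have h := abs_legP_diff2_sub_hess_le β α i j ht
    have e : legP β α (t + Pi.single i 1 + Pi.single j 1) - legP β α (t + Pi.single i 1) - legP β α (t + Pi.single j 1) + legP β α t
        - (if β = α then c4 * hessInvSq i j (toReal t) else 0)
      = legP β α (t + Pi.single i 1 + Pi.single j 1) - legP β α (t + Pi.single i 1) - legP β α (t + Pi.single j 1) + legP β α t
        - (if β = α then c4 * hessInvSq i j (toReal t) else 0) := rfl
    exact h

/-- [our object] **(D0)–(D2) FOR THE FORWARD ORIENTATION** in the shape `hDG` (`R₀ = 4`, `cL = c₄`). -/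
theorem dictG_Pker (α β : Fin 4) (t : Pt) (ht : 4 ≤ supNorm t) :
    |Pker 0 t (Sum.inl α) (Sum.inl β) - MarginalUniqueness.δ α β * (c4 * invSq (toReal t))| ≤ D0P / (supNorm t : ℝ) ^ 3
      ∧ (∀ i, |Δ_[(Pi.single i 1 : Pt)] (fun v => Pker 0 v (Sum.inl α) (Sum.inl β)) t
          - MarginalUniqueness.δ α β * (c4 * d1InvSq i (toReal t))| ≤ D1P / (supNorm t : ℝ) ^ 4)
      ∧ (∀ i j, |Δ_[(Pi.single i 1 : Pt)] (Δ_[(Pi.single j 1 : Pt)] (fun v => Pker 0 v (Sum.inl α) (Sum.inl β))) t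
          - MarginalUniqueness.δ α β * (c4 * hessInvSq i j (toReal t))| ≤ D2P / (supNorm t : ℝ) ^ 5) := by
  have ht0 : t ≠ 0 := by
    intro h; rw [h] at ht; rw [supNorm_eq_zero_iff.mpr rfl] at ht; omega
  have ht2 : 2 ≤ supNorm t := le_trans (by norm_num) ht
  refine ⟨?_, fun i => ?_, fun i j => ?_⟩
  · rw [Pker_zero_inl_inl, delta_mul_eq_ite]
    exact abs_legP_sub_invSq_le α β ht0
  · rw [Pker_fwd_eq_legP, fwdDiff_apply', delta_mul_eq_ite]
    exact abs_legP_diff_sub_d1_le α β i ht2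
  · rw [Pker_fwd_eq_legP, fwdDiff₂_apply', delta_mul_eq_ite]
    exact abs_legP_diff2_sub_hess_le α β i j ht

/-- [our object] **(L0)–(L3) FOR THE REFLECTED ORIENTATION** in the shape `hF` (`(A₀,A₁,A₂,A₃) = (A0P,A1P,A2P,A3P)`; `ExpLocalisedBubblePker.letters_Pker_bwd` on the field block). -/
theorem gradedF_Pker (α β : Fin 4) (t : Pt) :
    |Pker 0 (-t) (Sum.inl α) (Sum.inl β)| ≤ A0P / ((supNorm t : ℝ) + 1) ^ 2
      ∧ (∀ i, |Δ_[(Pi.single i 1 : Pt)] (fun v => Pker 0 (-v) (Sum.inl α) (Sum.inl β)) t| ≤ A1P / ((supNorm t : ℝ) + 1) ^ 3)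
      ∧ (∀ i j, |Δ_[(Pi.single i 1 : Pt)] (Δ_[(Pi.single j 1 : Pt)] (fun v => Pker 0 (-v) (Sum.inl α) (Sum.inl β))) t| ≤ A2P / ((supNorm t : ℝ) + 1) ^ 4)
      ∧ (∀ i j l, |Δ_[(Pi.single i 1 : Pt)] (Δ_[(Pi.single j 1 : Pt)] (Δ_[(Pi.single l 1 : Pt)] (fun v => Pker 0 (-v) (Sum.inl α) (Sum.inl β)))) t|
          ≤ A3P / ((supNorm t : ℝ) + 1) ^ 5) :=
  letters_Pker_bwd (Sum.inl α) (Sum.inl β) t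

/-- [our object] **(L0)–(L3) FOR THE FORWARD ORIENTATION** in the shape `hG`. -/
theorem gradedG_Pker (α β : Fin 4) (t : Pt) :
    |Pker 0 t (Sum.inl α) (Sum.inl β)| ≤ A0P / ((supNorm t : ℝ) + 1) ^ 2
      ∧ (∀ i, |Δ_[(Pi.single i 1 : Pt)] (fun v => Pker 0 v (Sum.inl α) (Sum.inl β)) t| ≤ A1P / ((supNorm t : ℝ) + 1) ^ 3)
      ∧ (∀ i j, |Δ_[(Pi.single i 1 : Pt)] (Δ_[(Pi.single j 1 : Pt)] (fun v => Pker 0 v (Sum.inl α) (Sum.inl β))) t| ≤ A2P / ((supNorm t : ℝ) + 1) ^ 4)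
      ∧ (∀ i j l, |Δ_[(Pi.single i 1 : Pt)] (Δ_[(Pi.single j 1 : Pt)] (Δ_[(Pi.single l 1 : Pt)] (fun v => Pker 0 v (Sum.inl α) (Sum.inl β)))) t|
          ≤ A3P / ((supNorm t : ℝ) + 1) ^ 5) :=
  letters_Pker_fwd (Sum.inl α) (Sum.inl β) t

/-! ## §3 The gluon-sector END at `Pker` -/

section End

variable {V : Fin 4 → Site 4 → MKer 4 (Fib 3)} {Cs δ : ℝ}

/-- **THE GLUON-SECTOR END OF H2-ASM-3 AT THE PERFECT GLUON LEG** [our object] (row H2-ASM-5, module A): for EVERY admissible cubic family `V` —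
(a1) `LocStencil V Cs δ` with `0 < δ`, (a2) translation covariance, (a3) TOTAL zero mass of every field block (E-FP-7-1) — and every `z` with `4 ≤ ‖z‖∞`:
`|bubble Pker (V μ 0) (V ν z) − leadGerm c₄ (cubicGermOf V) μ ν (toReal z)| ≤ Cbub 4 Cs δ A0P A1P A2P A3P D0P D1P D2P ∕ ‖z‖∞⁷`.
`PolarizationGerm.abs_bubble_sub_leadGerm_le` BY NAME at `A := Pker`, `cL := c₄`, `R₀ := 4`, with every leg hypothesis supplied by §2. -/
theorem abs_bubble_Pker_sub_leadGerm_le (hδ : 0 < δ) (hV : LocStencil V Cs δ)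
    (hcov : ∀ (lam : Fin 4) (w : Site 4), V lam w = shiftK (-w) (V lam 0))
    (h0 : ∀ (lam α β : Fin 4), ∑' p : Pt × Pt, V lam 0 p.1 p.2 (Sum.inl α) (Sum.inl β) = 0)
    (μ ν : Fin 4) {z : Pt} (hz : 4 ≤ supNorm z) :
    |bubble Pker (V μ 0) (V ν z) - leadGerm c4 (cubicGermOf V) μ ν (toReal z)|
      ≤ Cbub 4 Cs δ A0P A1P A2P A3P D0P D1P D2P / (supNorm z : ℝ) ^ 7 :=
  abs_bubble_sub_leadGerm_le (A := Pker) (cL := c4) (R₀ := 4) hδ abs_Pker_le Pker_translate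
    (fun x y α m => Pker_inl_inr x y α m) (fun x y m α => Pker_inr_inl x y m α) (fun x y m m' => Pker_inr_inr x y m m')
    gradedF_Pker gradedG_Pker (by norm_num) dictF_Pker dictG_Pker hV hcov h0 μ ν hz

end End

end Summit.QuantumFields.BalabanUV.Beta.FP.PolarizationGermPker

end
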